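import Summits.HubbardSuperconductivity.HubbardSuperconductivity.Theses.FunctionFieldCertificate
import Summits.HubbardSuperconductivity.HubbardSuperconductivity.Theorems.FunctionFieldCertificateMesoscopicPairOrderSplit
import Summits.HubbardSuperconductivity.HubbardSuperconductivity.Theorems.FunctionFieldCertificateMesoscopicPairOrderSeedForms
import HarnessLib

/-!
# `MesoscopicPairOrder` (stmt-HubbardSuperconductivity-7331), line `redirect_birth`:
# order + profile position the stubs (Q) and (D) — pointwise core

Support file for the crux (route `FunctionFieldCertificate`, pole-free half; lead c9 of line
`redirect_birth`, planner cstrat-r1), file 1/2 of the typed POSITION of the line's cut of piece (B)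
`LeakBeatingBlockPairSeed` along the scale axis into

* (Q) a pair-fluctuation FLOOR at every fixed block scale, `c(U,δ,R) ≤ T_R(ψ)/L²`, and
* (D) a DOUBLING LAW `θ · T_R(ψ) ≤ T_{2R}(ψ)`, `θ > 2`, for all `R ≥ R₁` (load-bearing),

in every normalised `(N_L, S^z = 0)`-sector ground state `ψ` of `hubbardTorus 2 L 1 U` on all large even
tori, `T_R(ψ) = Σ_{x,y} Πᵢ (1 - |(y - x)ᵢ|_L/R)₊ Re⟨P_x ψ, P_y ψ⟩`, `P_x = localPair dWaveFormFactor L x`.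
The line card asserts "UPO ∧ (A) ⇒ (D)" without proof; here it becomes a theorem with the sharp rate
(nothing in this file proves (Q), (D) or the crux, which are open physics):

* `boxSum_div_sq_ge_of_order` — order `a ≤ Re⟨ψ, Δ_dᴴΔ_d ψ⟩/L⁴` ⇒ `a R² ≤ T_R(ψ)/L²` (Fejér floor).
* `boxSum_div_sq_le_of_profile` — a Goldstone pair profile `S_ψ(m) ≤ S + A/|q_m|` (`m ≠ 0`) ⇒
  `T_R(ψ)/L² ≤ R²·(Re⟨ψ, ΔᴴΔψ⟩/L⁴ + 32ε(Sε + A) + (S + A/ε)/R²)` (the pointwise one-scale closure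
  `pairStructureFactor_zero_ge_of_seed_of_profile` read as a zero-mode CEILING).
* `doubling_of_order_of_profile` — **pointwise, model-free, one vector**: profile + order force
  `θ·T_R(ψ) ≤ T_{2R}(ψ)` as soon as `θ ≤ 4` and `θ·leak(ε,R) ≤ (4 - θ)·a`.
* `fluctuationFloor_of_uniformPairOrderAt` — uniform sector pair order at `(U, δ)` ⇒ the body of (Q)
  there at every scale (`c = a`).
* `coherenceDoubling_of_uniformPairOrderAt_of_profileAt` — uniform sector pair order + profile at `(U, δ)`
  ⇒ the body of (D) there for EVERY `θ < 4` (`θ_eff → 4`; the registered `θ > 2` is half of what order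
  delivers). File 2/2 (`…DoublingPosition`) turns this into: given (A), crux ⟺ (Q) ∧ (D) at a common point.

Sources: Kennedy–Lieb–Shastry, PRL 61 (1988) 2582 [KLS1988PRL]; Dyson–Lieb–Simon, J. Stat. Phys. 18
(1978) 335, Thm 4.2 [DysonLiebSimon1978]; Fröhlich–Spencer, CMP 81 (1981) 527 (scale-by-scale propagation
of coherence — the shape of (D)); Stein–Shakarchi, *Fourier Analysis* (2003), Ch. 2. Folklore; no
definition is introduced and no registered stub, piece or the crux is claimed.
-/

noncomputable section

-- the summit namespace repeats the problem name by design (D-0017)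
set_option linter.dupNamespace false

namespace Summit.HubbardSuperconductivity.HubbardSuperconductivity.Theorems.FunctionFieldCertificate

open Matrix Finset Filter
open Literature.Probability.LatticeModels Literature.MathematicalPhysics.QuantumLattice
open Summit.HubbardSuperconductivity.HubbardSuperconductivity.Theses.FunctionFieldCertificate
open scoped ComplexOrder ComplexConjugate

section OneTorus

variable {L : ℕ} [NeZero L]

/-- **Order ⇒ Fejér-box floor at every scale** (pointwise; `0 < R`, `2R ≤ L`): if
`a ≤ Re⟨ψ, Δ_dᴴ Δ_d ψ⟩/L⁴` then `a R² ≤ T_R(ψ)/L²` — the Fejér floor `fejerBox_floor_pairField`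
(the zero mode carries kernel weight `R²`). Kennedy–Lieb–Shastry, PRL 61 (1988) 2582. [folklore] -/
theorem boxSum_div_sq_ge_of_order (R : ℕ) (hR : 0 < R) (hRL : 2 * R ≤ L) {a : ℝ}
    (ψ : Fock (Orb (FermionTorus 2 L)))
    (ha : a ≤ (star ψ ⬝ᵥ Matrix.mulVec (Matrix.conjTranspose (pairField dWaveFormFactor L) *
      pairField dWaveFormFactor L) ψ).re / (L : ℝ) ^ 4) :
    a * (R : ℝ) ^ 2 ≤ (∑ x : TorusSite 2 L, ∑ y : TorusSite 2 L,
        (∏ i : Fin 2, max 0 (1 - |(((y i - x i).valMinAbs : ℤ) : ℝ)| / (R : ℝ))) *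
          (star (localPair dWaveFormFactor L x *ᵥ ψ) ⬝ᵥ (localPair dWaveFormFactor L y *ᵥ ψ)).re) /
        (L : ℝ) ^ 2 := by
  have hLpos : (0 : ℝ) < L := Nat.cast_pos.2 (Nat.pos_of_ne_zero (NeZero.ne L))
  have hL2 : (0 : ℝ) < (L : ℝ) ^ 2 := by positivity
  have hL4 : (0 : ℝ) < (L : ℝ) ^ 4 := by positivity
  have hfloor := fejerBox_floor_pairField dWaveFormFactor L R hR hRL ψ
  set Q : ℝ := (star ψ ⬝ᵥ Matrix.mulVec (Matrix.conjTranspose (pairField dWaveFormFactor L) *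
      pairField dWaveFormFactor L) ψ).re with hQ
  rw [le_div_iff₀ hL4] at ha
  rw [le_div_iff₀ hL2]
  -- `a R² L² ≤ R² Q / L² ≤ T_R`
  have h1 : a * (R : ℝ) ^ 2 * (L : ℝ) ^ 2 ≤ (R : ℝ) ^ 2 * Q / (L : ℝ) ^ 2 := by
    rw [le_div_iff₀ hL2]
    have hR2 : (0 : ℝ) ≤ (R : ℝ) ^ 2 := by positivity
    calc a * (R : ℝ) ^ 2 * (L : ℝ) ^ 2 * (L : ℝ) ^ 2 = (a * (L : ℝ) ^ 4) * (R : ℝ) ^ 2 := by ring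
      _ ≤ Q * (R : ℝ) ^ 2 := mul_le_mul_of_nonneg_right ha hR2
      _ = (R : ℝ) ^ 2 * Q := by ring
  exact h1.trans hfloor

/-- **Profile + one-scale value ⇒ zero-mode CEILING on the box functional** (pointwise; `0 < R`,
`2R ≤ L`, `0 < ε`, `S, A ≥ 0`): a Goldstone pair profile `S_ψ(m) ≤ S + A/|q_m|` (`m ≠ 0`) forces
`T_R(ψ)/L² ≤ R² · (Re⟨ψ, Δ_dᴴΔ_d ψ⟩/L⁴ + 32ε(Sε + A) + (S + A/ε)/R²)` — the pointwise one-scale closure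
`pairStructureFactor_zero_ge_of_seed_of_profile` read as an upper bound (applied with the seed margin
`m₀ := T_R(ψ)/(R²L²)` it attains). Dyson–Lieb–Simon (1978) Thm 4.2; KLS (1988). [folklore] -/
theorem boxSum_div_sq_le_of_profile (R : ℕ) (hR : 0 < R) (hRL : 2 * R ≤ L) {ε S A : ℝ}
    (hε : 0 < ε) (hS : 0 ≤ S) (hA : 0 ≤ A) (ψ : Fock (Orb (FermionTorus 2 L)))
    (hprof : ∀ m : TorusSite 2 L, m ≠ 0 →
      pairStructureFactor dWaveFormFactor L ψ m ≤ S + A / Real.sqrt (momentumNormSq L m)) :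
    (∑ x : TorusSite 2 L, ∑ y : TorusSite 2 L,
        (∏ i : Fin 2, max 0 (1 - |(((y i - x i).valMinAbs : ℤ) : ℝ)| / (R : ℝ))) *
          (star (localPair dWaveFormFactor L x *ᵥ ψ) ⬝ᵥ (localPair dWaveFormFactor L y *ᵥ ψ)).re) /
        (L : ℝ) ^ 2 ≤
      (R : ℝ) ^ 2 * ((star ψ ⬝ᵥ Matrix.mulVec (Matrix.conjTranspose (pairField dWaveFormFactor L) *
          pairField dWaveFormFactor L) ψ).re / (L : ℝ) ^ 4 +
        32 * ε * (S * ε + A) + (S + A / ε) / (R : ℝ) ^ 2) := by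
  have hLpos : (0 : ℝ) < L := Nat.cast_pos.2 (Nat.pos_of_ne_zero (NeZero.ne L))
  have hL2 : (0 : ℝ) < (L : ℝ) ^ 2 := by positivity
  have hL4 : (0 : ℝ) < (L : ℝ) ^ 4 := by positivity
  have hRpos : (0 : ℝ) < R := Nat.cast_pos.2 hR
  have hR2 : (0 : ℝ) < (R : ℝ) ^ 2 := by positivity
  set T : ℝ := ∑ x : TorusSite 2 L, ∑ y : TorusSite 2 L,
        (∏ i : Fin 2, max 0 (1 - |(((y i - x i).valMinAbs : ℤ) : ℝ)| / (R : ℝ))) *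
          (star (localPair dWaveFormFactor L x *ᵥ ψ) ⬝ᵥ (localPair dWaveFormFactor L y *ᵥ ψ)).re
    with hT
  set Q : ℝ := (star ψ ⬝ᵥ Matrix.mulVec (Matrix.conjTranspose (pairField dWaveFormFactor L) *
      pairField dWaveFormFactor L) ψ).re with hQ
  -- apply the one-scale closure with the margin it attains, `m₀ := T / (R² L²)`
  have hseed : T / ((R : ℝ) ^ 2 * (L : ℝ) ^ 2) * (R : ℝ) ^ 2 ≤ T / (L : ℝ) ^ 2 := by
    have e : T / ((R : ℝ) ^ 2 * (L : ℝ) ^ 2) * (R : ℝ) ^ 2 = T / (L : ℝ) ^ 2 := by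
      field_simp
    exact e.le
  have hcore := pairStructureFactor_zero_ge_of_seed_of_profile (L := L) R hR hRL hε hS hA ψ hprof
    (m₀ := T / ((R : ℝ) ^ 2 * (L : ℝ) ^ 2)) hseed
  rw [pairStructureFactor_zero_eq_re_dotProduct] at hcore
  -- `(m₀ - leak) L² ≤ Q / L²`, i.e. `m₀ ≤ Q/L⁴ + leak`
  have hm : T / ((R : ℝ) ^ 2 * (L : ℝ) ^ 2) ≤
      Q / (L : ℝ) ^ 4 + 32 * ε * (S * ε + A) + (S + A / ε) / (R : ℝ) ^ 2 := by
    have h1 : (T / ((R : ℝ) ^ 2 * (L : ℝ) ^ 2) - 32 * ε * (S * ε + A) - (S + A / ε) / (R : ℝ) ^ 2) ≤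
        Q / (L : ℝ) ^ 4 := by
      rw [le_div_iff₀ hL4]
      calc (T / ((R : ℝ) ^ 2 * (L : ℝ) ^ 2) - 32 * ε * (S * ε + A) - (S + A / ε) / (R : ℝ) ^ 2) *
            (L : ℝ) ^ 4 =
          ((T / ((R : ℝ) ^ 2 * (L : ℝ) ^ 2) - 32 * ε * (S * ε + A) - (S + A / ε) / (R : ℝ) ^ 2) *
            (L : ℝ) ^ 2) * (L : ℝ) ^ 2 := by ring
        _ ≤ Q / (L : ℝ) ^ 2 * (L : ℝ) ^ 2 := mul_le_mul_of_nonneg_right hcore hL2.le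
        _ = Q := by field_simp
    linarith
  calc T / (L : ℝ) ^ 2 = (R : ℝ) ^ 2 * (T / ((R : ℝ) ^ 2 * (L : ℝ) ^ 2)) := by
        field_simp
    _ ≤ (R : ℝ) ^ 2 * (Q / (L : ℝ) ^ 4 + 32 * ε * (S * ε + A) + (S + A / ε) / (R : ℝ) ^ 2) :=
        mul_le_mul_of_nonneg_left hm hR2.le

/-- **DOUBLING FROM ORDER + PROFILE** (pointwise, model-free, one vector). Let `0 < R`, `4R ≤ L`,
`0 < ε`, `S, A ≥ 0`, `0 ≤ θ ≤ 4`. If `ψ` has a Goldstone pair profile `S_ψ(m) ≤ S + A/|q_m|` (`m ≠ 0`),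
pair order `a ≤ Re⟨ψ, Δ_dᴴΔ_d ψ⟩/L⁴`, and the leak at scale `R` is small against the order,
`θ · (32ε(Sε + A) + (S + A/ε)/R²) ≤ (4 - θ) · a`, then `θ · T_R(ψ) ≤ T_{2R}(ψ)`.
Proof: `θ T_R ≤ θ R² L² (q + leak)` (`boxSum_div_sq_le_of_profile`, `q = Re⟨ψ, ΔᴴΔψ⟩/L⁴ ≥ a`) and
`T_{2R} ≥ (2R)² L² q` (`boxSum_div_sq_ge_of_order` at scale `2R`); `θ(q + leak) ≤ θ q + (4 - θ) a ≤ 4q`.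
So in an ORDERED state the doubling ratio tends to `4` along the scales, `R ≫ √((S + A/ε)/a)`.
Kennedy–Lieb–Shastry (1988); Fröhlich–Spencer, CMP 81 (1981) 527 (shape). [folklore] -/
theorem doubling_of_order_of_profile (R : ℕ) (hR : 0 < R) (hRL : 4 * R ≤ L) {ε S A θ a : ℝ}
    (hε : 0 < ε) (hS : 0 ≤ S) (hA : 0 ≤ A) (hθ : 0 ≤ θ) (hθ4 : θ ≤ 4)
    (ψ : Fock (Orb (FermionTorus 2 L)))
    (hprof : ∀ m : TorusSite 2 L, m ≠ 0 →
      pairStructureFactor dWaveFormFactor L ψ m ≤ S + A / Real.sqrt (momentumNormSq L m))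
    (ha : a ≤ (star ψ ⬝ᵥ Matrix.mulVec (Matrix.conjTranspose (pairField dWaveFormFactor L) *
      pairField dWaveFormFactor L) ψ).re / (L : ℝ) ^ 4)
    (hleak : θ * (32 * ε * (S * ε + A) + (S + A / ε) / (R : ℝ) ^ 2) ≤ (4 - θ) * a) :
    θ * (∑ x : TorusSite 2 L, ∑ y : TorusSite 2 L,
        (∏ i : Fin 2, max 0 (1 - |(((y i - x i).valMinAbs : ℤ) : ℝ)| / (R : ℝ))) *
          (star (localPair dWaveFormFactor L x *ᵥ ψ) ⬝ᵥ (localPair dWaveFormFactor L y *ᵥ ψ)).re) ≤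
      ∑ x : TorusSite 2 L, ∑ y : TorusSite 2 L,
        (∏ i : Fin 2, max 0 (1 - |(((y i - x i).valMinAbs : ℤ) : ℝ)| / ((2 * R : ℕ) : ℝ))) *
          (star (localPair dWaveFormFactor L x *ᵥ ψ) ⬝ᵥ (localPair dWaveFormFactor L y *ᵥ ψ)).re := by
  have hLpos : (0 : ℝ) < L := Nat.cast_pos.2 (Nat.pos_of_ne_zero (NeZero.ne L))
  have hL2 : (0 : ℝ) < (L : ℝ) ^ 2 := by positivity
  have hRpos : (0 : ℝ) < R := Nat.cast_pos.2 hR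
  have hR2 : (0 : ℝ) < (R : ℝ) ^ 2 := by positivity
  have h2R : 0 < 2 * R := by omega
  have h2RL : 2 * R ≤ L := by omega
  have h4RL : 2 * (2 * R) ≤ L := by omega
  -- upper bound at scale `R`, lower bound at scale `2R`
  have hup := boxSum_div_sq_le_of_profile (L := L) R hR h2RL hε hS hA ψ hprof
  have hlow := boxSum_div_sq_ge_of_order (L := L) (2 * R) h2R h4RL ψ
    (le_refl ((star ψ ⬝ᵥ Matrix.mulVec (Matrix.conjTranspose (pairField dWaveFormFactor L) *
      pairField dWaveFormFactor L) ψ).re / (L : ℝ) ^ 4))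
  rw [div_le_iff₀ hL2] at hup
  rw [le_div_iff₀ hL2] at hlow
  set q : ℝ := (star ψ ⬝ᵥ Matrix.mulVec (Matrix.conjTranspose (pairField dWaveFormFactor L) *
      pairField dWaveFormFactor L) ψ).re / (L : ℝ) ^ 4 with hq
  have hqa : a ≤ q := ha
  -- `θ (q + leak) ≤ 4 q`
  have hkey : θ * (q + 32 * ε * (S * ε + A) + (S + A / ε) / (R : ℝ) ^ 2) ≤ 4 * q := by
    have h1 : (4 - θ) * a ≤ (4 - θ) * q := mul_le_mul_of_nonneg_left hqa (by linarith)
    linarith [hleak, h1]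
  have hcast : ((2 * R : ℕ) : ℝ) = 2 * (R : ℝ) := by push_cast; ring
  calc θ * (∑ x : TorusSite 2 L, ∑ y : TorusSite 2 L,
        (∏ i : Fin 2, max 0 (1 - |(((y i - x i).valMinAbs : ℤ) : ℝ)| / (R : ℝ))) *
          (star (localPair dWaveFormFactor L x *ᵥ ψ) ⬝ᵥ (localPair dWaveFormFactor L y *ᵥ ψ)).re)
      ≤ θ * ((R : ℝ) ^ 2 * (q + 32 * ε * (S * ε + A) + (S + A / ε) / (R : ℝ) ^ 2) * (L : ℝ) ^ 2) :=
        mul_le_mul_of_nonneg_left hup hθ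
    _ = (θ * (q + 32 * ε * (S * ε + A) + (S + A / ε) / (R : ℝ) ^ 2)) * (R : ℝ) ^ 2 * (L : ℝ) ^ 2 := by
        ring
    _ ≤ (4 * q) * (R : ℝ) ^ 2 * (L : ℝ) ^ 2 := by gcongr
    _ = q * ((2 * R : ℕ) : ℝ) ^ 2 * (L : ℝ) ^ 2 := by rw [hcast]; ring
    _ ≤ _ := hlow

end OneTorus

/-! ### At a point `(U, δ)`: uniform sector pair order positions (Q) and (D) -/

/-- **Uniform sector pair order ⇒ the body of stub (Q) at that point, every scale** (`c = a`): if at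
`(U, δ)` every normalised `(N_L, 0)`-sector ground state of every large even torus has
`a ≤ Re⟨ψ, Δ_dᴴΔ_d ψ⟩/L⁴` with `a > 0`, then for every `R > 0`, eventually in even `L`, every such ground
state has `a ≤ T_R(ψ)/L²` (indeed `a R²`). Kennedy–Lieb–Shastry (1988). [folklore] -/
theorem fluctuationFloor_of_uniformPairOrderAt {U δ a : ℝ} (ha : 0 < a)
    (hupo : ∃ L₀ : ℕ, ∀ (L : ℕ) [NeZero L], L₀ ≤ L → Even L →
      ∀ ψ : Fock (Orb (FermionTorus 2 L)), star ψ ⬝ᵥ ψ = 1 →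
        IsGroundStateInSector (hubbardTorus 2 L 1 U) (2 * ⌊(1 - δ) * (L : ℝ) ^ 2 / 2⌋₊) 0 ψ →
          a ≤ (star ψ ⬝ᵥ Matrix.mulVec (Matrix.conjTranspose (pairField dWaveFormFactor L) *
            pairField dWaveFormFactor L) ψ).re / (L : ℝ) ^ 4) :
    ∀ R : ℕ, 0 < R → ∃ c : ℝ, 0 < c ∧ ∃ L₀ : ℕ, ∀ (L : ℕ) [NeZero L], L₀ ≤ L → Even L →
      ∀ ψ : Fock (Orb (FermionTorus 2 L)), star ψ ⬝ᵥ ψ = 1 →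
        IsGroundStateInSector (hubbardTorus 2 L 1 U) (2 * ⌊(1 - δ) * (L : ℝ) ^ 2 / 2⌋₊) 0 ψ →
          c ≤ (∑ x : TorusSite 2 L, ∑ y : TorusSite 2 L,
            (∏ i : Fin 2, max 0 (1 - |(((y i - x i).valMinAbs : ℤ) : ℝ)| / (R : ℝ))) *
              (star (localPair dWaveFormFactor L x *ᵥ ψ) ⬝ᵥ (localPair dWaveFormFactor L y *ᵥ ψ)).re) /
            (L : ℝ) ^ 2 := by
  intro R hR
  obtain ⟨L₀, h⟩ := hupo
  refine ⟨a, ha, max L₀ (2 * R), fun L _ hL hE ψ hψ hgs => ?_⟩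
  have hL₀ : L₀ ≤ L := le_of_max_le_left hL
  have h2R : 2 * R ≤ L := le_of_max_le_right hL
  have hfloor := boxSum_div_sq_ge_of_order (L := L) R hR h2R ψ (h L hL₀ hE ψ hψ hgs)
  have hR1 : (1 : ℝ) ≤ (R : ℝ) ^ 2 := by
    have : (1 : ℝ) ≤ R := by exact_mod_cast hR
    nlinarith
  calc a = a * 1 := (mul_one a).symm
    _ ≤ a * (R : ℝ) ^ 2 := mul_le_mul_of_nonneg_left hR1 ha.le
    _ ≤ _ := hfloor

/-- **Uniform sector pair order + Goldstone pair profile ⇒ the body of stub (D) at that point, for EVERY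
`θ < 4`.** If at `(U, δ)` every normalised `(N_L, 0)`-sector ground state of every large even torus has
the profile `S_ψ(m) ≤ S + A/|q_m|` (`m ≠ 0`) and the order `a ≤ Re⟨ψ, Δ_dᴴΔ_d ψ⟩/L⁴` (`a > 0`), then for
every `θ < 4` there is `R₁` such that for all `R ≥ R₁`, eventually in even `L`, every such ground state
has `θ · T_R(ψ) ≤ T_{2R}(ψ)`. (Choice: `ε` with `32ε(Sε + A) ≤ (4-θ)a/(2θ)`, then `R₁² ≥ 2θ(S + A/ε)/((4-θ)a)`.)
So the registered `θ > 2` of (D) is half of what order delivers; (D) is NECESSARY for uniform pair order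
given the profile. Kennedy–Lieb–Shastry (1988); Fröhlich–Spencer (1981) (shape). [folklore] -/
theorem coherenceDoubling_of_uniformPairOrderAt_of_profileAt {U δ S A a : ℝ} (hS : 0 ≤ S) (hA : 0 ≤ A)
    (ha : 0 < a)
    (hprof : ∃ L₀ : ℕ, ∀ (L : ℕ) [NeZero L], L₀ ≤ L → Even L →
      ∀ ψ : Fock (Orb (FermionTorus 2 L)), star ψ ⬝ᵥ ψ = 1 →
        IsGroundStateInSector (hubbardTorus 2 L 1 U) (2 * ⌊(1 - δ) * (L : ℝ) ^ 2 / 2⌋₊) 0 ψ →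
          ∀ m : TorusSite 2 L, m ≠ 0 →
            pairStructureFactor dWaveFormFactor L ψ m ≤ S + A / Real.sqrt (momentumNormSq L m))
    (hupo : ∃ L₀ : ℕ, ∀ (L : ℕ) [NeZero L], L₀ ≤ L → Even L →
      ∀ ψ : Fock (Orb (FermionTorus 2 L)), star ψ ⬝ᵥ ψ = 1 →
        IsGroundStateInSector (hubbardTorus 2 L 1 U) (2 * ⌊(1 - δ) * (L : ℝ) ^ 2 / 2⌋₊) 0 ψ →
          a ≤ (star ψ ⬝ᵥ Matrix.mulVec (Matrix.conjTranspose (pairField dWaveFormFactor L) *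
            pairField dWaveFormFactor L) ψ).re / (L : ℝ) ^ 4) :
    ∀ θ : ℝ, θ < 4 → ∃ R₁ : ℕ, ∀ R : ℕ, R₁ ≤ R → ∃ L₀ : ℕ, ∀ (L : ℕ) [NeZero L], L₀ ≤ L → Even L →
      ∀ ψ : Fock (Orb (FermionTorus 2 L)), star ψ ⬝ᵥ ψ = 1 →
        IsGroundStateInSector (hubbardTorus 2 L 1 U) (2 * ⌊(1 - δ) * (L : ℝ) ^ 2 / 2⌋₊) 0 ψ →
          θ * (∑ x : TorusSite 2 L, ∑ y : TorusSite 2 L,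
            (∏ i : Fin 2, max 0 (1 - |(((y i - x i).valMinAbs : ℤ) : ℝ)| / (R : ℝ))) *
              (star (localPair dWaveFormFactor L x *ᵥ ψ) ⬝ᵥ (localPair dWaveFormFactor L y *ᵥ ψ)).re) ≤
          (∑ x : TorusSite 2 L, ∑ y : TorusSite 2 L,
            (∏ i : Fin 2, max 0 (1 - |(((y i - x i).valMinAbs : ℤ) : ℝ)| / ((2 * R : ℕ) : ℝ))) *
              (star (localPair dWaveFormFactor L x *ᵥ ψ) ⬝ᵥ (localPair dWaveFormFactor L y *ᵥ ψ)).re) := by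
  intro θ hθ4
  obtain ⟨L_A, hPA⟩ := hprof
  obtain ⟨L_U, hUA⟩ := hupo
  by_cases hθ : θ ≤ 0
  · -- trivial: `θ T_R ≤ 0 ≤ T_{2R}`
    refine ⟨1, fun R hR => ⟨max L_U (4 * R), fun L _ hL hE ψ hψ hgs => ?_⟩⟩
    have hRpos : 0 < R := hR
    have h4R : 4 * R ≤ L := le_of_max_le_right hL
    have h2R : 2 * R ≤ L := by omega
    have hT := boxSum_nonneg (L := L) R hRpos h2R ψ
    have hT2 := boxSum_nonneg (L := L) (2 * R) (by omega) (by omega) ψ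
    have h1 : θ * (∑ x : TorusSite 2 L, ∑ y : TorusSite 2 L,
        (∏ i : Fin 2, max 0 (1 - |(((y i - x i).valMinAbs : ℤ) : ℝ)| / (R : ℝ))) *
          (star (localPair dWaveFormFactor L x *ᵥ ψ) ⬝ᵥ (localPair dWaveFormFactor L y *ᵥ ψ)).re) ≤ 0 :=
      mul_nonpos_of_nonpos_of_nonneg hθ hT
    exact h1.trans hT2
  push Not at hθ
  -- budget: `gap = (4 - θ) a / (2θ) > 0`; window radius `ε`, then the scale threshold
  have hgap : 0 < (4 - θ) * a / (2 * θ) := by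
    have : 0 < 4 - θ := by linarith
    positivity
  set g : ℝ := (4 - θ) * a / (2 * θ) with hg
  -- choose `ε ≤ 1` with `32 ε (S + A) ≤ g`
  set ε : ℝ := min 1 (g / (32 * (S + A + 1))) with hε
  have hεpos : 0 < ε := lt_min one_pos (by positivity)
  have hε1 : ε ≤ 1 := min_le_left _ _
  have hwin : 32 * ε * (S * ε + A) ≤ g := by
    have h1 : S * ε + A ≤ S + A + 1 := by nlinarith
    have h2 : 32 * ε * (S * ε + A) ≤ 32 * ε * (S + A + 1) :=
      mul_le_mul_of_nonneg_left h1 (by positivity)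
    have h3 : ε ≤ g / (32 * (S + A + 1)) := min_le_right _ _
    have h4 : 32 * ε * (S + A + 1) ≤ g := by
      rw [le_div_iff₀ (by positivity)] at h3
      linarith
    linarith
  -- choose `R₁` with `(S + A/ε)/R₁² ≤ (S + A/ε)/R₁ ≤ g`
  obtain ⟨R₁, hR₁⟩ := exists_nat_gt ((S + A / ε) / g)
  refine ⟨max R₁ 1, fun R hR => ⟨max (max L_A L_U) (4 * R), fun L _ hL hE ψ hψ hgs => ?_⟩⟩
  have hRge1 : 1 ≤ R := le_trans (le_max_right _ _) hR
  have hRgeR₁ : R₁ ≤ R := le_trans (le_max_left _ _) hR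
  have hRpos : 0 < R := hRge1
  have hRreal : (1 : ℝ) ≤ R := by exact_mod_cast hRge1
  have hRposr : (0 : ℝ) < R := by linarith
  have h4R : 4 * R ≤ L := le_of_max_le_right hL
  have hLA : L_A ≤ L := le_trans (le_max_left _ _) (le_of_max_le_left hL)
  have hLU : L_U ≤ L := le_trans (le_max_right _ _) (le_of_max_le_left hL)
  have htail : (S + A / ε) / (R : ℝ) ^ 2 ≤ g := by
    have hSA : 0 ≤ S + A / ε := by positivity
    have hR1' : (R₁ : ℝ) ≤ R := by exact_mod_cast hRgeR₁
    have hlt : (S + A / ε) / g < R := lt_of_lt_of_le hR₁ hR1'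
    have h1 : S + A / ε ≤ g * R := by
      rw [div_lt_iff₀ hgap] at hlt
      linarith
    have h2 : (S + A / ε) / (R : ℝ) ^ 2 ≤ (S + A / ε) / R := by
      apply div_le_div_of_nonneg_left hSA hRposr
      nlinarith
    have h3 : (S + A / ε) / (R : ℝ) ≤ g := by
      rw [div_le_iff₀ hRposr]
      linarith
    exact h2.trans h3
  have hleak : θ * (32 * ε * (S * ε + A) + (S + A / ε) / (R : ℝ) ^ 2) ≤ (4 - θ) * a := by
    have h1 : 32 * ε * (S * ε + A) + (S + A / ε) / (R : ℝ) ^ 2 ≤ 2 * g := by linarith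
    have h2 : θ * (2 * g) = (4 - θ) * a := by
      rw [hg]
      field_simp
    calc θ * (32 * ε * (S * ε + A) + (S + A / ε) / (R : ℝ) ^ 2) ≤ θ * (2 * g) :=
          mul_le_mul_of_nonneg_left h1 hθ.le
      _ = (4 - θ) * a := h2
  exact doubling_of_order_of_profile (L := L) R hRpos h4R hεpos hS hA hθ.le hθ4.le ψ
    (hPA L hLA hE ψ hψ hgs) (hUA L hLU hE ψ hψ hgs) hleak

/-- Registered sub-goal form (line `redirect_birth`, lead c9): uniform sector pair order + Goldstone pair
profile at `(U, δ)` ⇒ the body of stub (D) `stub_coherenceDoubling` there for every `θ < 4` —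
`coherenceDoubling_of_uniformPairOrderAt_of_profileAt` with all parameters explicit. [folklore] -/
theorem coherenceDoublingOfUniformPairOrderAtOfProfileAt : ∀ (U δ S A a : ℝ), 0 ≤ S → 0 ≤ A → 0 < a → (∃ L₀ : ℕ, ∀ (L : ℕ) [NeZero L], L₀ ≤ L → Even L → ∀ ψ : Fock (Orb (FermionTorus 2 L)), star ψ ⬝ᵥ ψ = 1 → IsGroundStateInSector (hubbardTorus 2 L 1 U) (2 * ⌊(1 - δ) * (L : ℝ) ^ 2 / 2⌋₊) 0 ψ → ∀ m : TorusSite 2 L, m ≠ 0 → pairStructureFactor dWaveFormFactor L ψ m ≤ S + A / Real.sqrt (momentumNormSq L m)) → (∃ L₀ : ℕ, ∀ (L : ℕ) [NeZero L], L₀ ≤ L → Even L → ∀ ψ : Fock (Orb (FermionTorus 2 L)), star ψ ⬝ᵥ ψ = 1 → IsGroundStateInSector (hubbardTorus 2 L 1 U) (2 * ⌊(1 - δ) * (L : ℝ) ^ 2 / 2⌋₊) 0 ψ → a ≤ (star ψ ⬝ᵥ Matrix.mulVec (Matrix.conjTranspose (pairField dWaveFormFactor L) * pairField dWaveFormFactor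 L) ψ).re / (L : ℝ) ^ 4) → ∀ θ : ℝ, θ < 4 → ∃ R₁ : ℕ, ∀ R : ℕ, R₁ ≤ R → ∃ L₀ : ℕ, ∀ (L : ℕ) [NeZero L], L₀ ≤ L → Even L → ∀ ψ : Fock (Orb (FermionTorus 2 L)), star ψ ⬝ᵥ ψ = 1 → IsGroundStateInSector (hubbardTorus 2 L 1 U) (2 * ⌊(1 - δ) * (L : ℝ) ^ 2 / 2⌋₊) 0 ψ → θ * (∑ x : TorusSite 2 L, ∑ y : TorusSite 2 L, (∏ i : Fin 2, max 0 (1 - |(((y i - x i).valMinAbs : ℤ) : ℝ)| / (R : ℝ))) * (star (localPair dWaveFormFactor L x *ᵥ ψ) ⬝ᵥ (localPair dWaveFormFactor L y *ᵥ ψ)).re) ≤ (∑ x : TorusSite 2 L, ∑ y : TorusSite 2 L, (∏ i : Fin 2, max 0 (1 - |(((y i - x i).valMinAbs : ℤ) : ℝ)| / ((2 * R : ℕ) : ℝ))) * (star (localPair dWaveFormFactor L x *ᵥ ψ) ⬝ᵥ (localPair dWaveFormFactor L y *ᵥ ψ)).re) :=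
  fun _ _ _ _ _ hS hA ha hprof hupo => coherenceDoubling_of_uniformPairOrderAt_of_profileAt hS hA ha hprof hupo

end Summit.HubbardSuperconductivity.HubbardSuperconductivity.Theorems.FunctionFieldCertificate
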